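import Mathlib
import HarnessLib
import Summits.PneNP.PneNP.Theorems.AeaCutRectanglesDutySymmetric

/-!
# Crux `FoolingMeasure` (stmt-PneNP-19727): ORBIT MEASURES CANNOT FOOL (a refuted weakening of the construction space)

Negative lemma of the lead prover (pnp-aea-p1, 2026-08-27) for the crux X1 of route `AeaCutRectangles`.
X1 asks for probability measures on loopless non-3-colourable edge sets over `Fin n` all of whose cut
rectangles over near-balanced cuts have mass `≤ 2^{-(n/2)·log₂ n - C·n}`.  The first measures one tries are
ORBIT MEASURES: the uniform random relabelling of ONE non-3-colourable graph `H` (`orbitMeasure H =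
symmetrise 𝟙_H`).  They fail, for a counting reason (AEA.md Prop 6.4(f); WITNESS-g1 §5 "N1"): over a cut `B`
of size `b`, the single Bob graph `β₀ = H[B]` together with all compatible Alice parts is a cut rectangle
inside NON-3-COL, and it contains every relabelling of `H` by a permutation fixing `B` pointwise — mass
`≥ (n-b)!/n! ≥ n^{-b} ≥ 2^{-(n/2)·log₂ n}` for `b ≤ n/2`, above X1's threshold for every `C ≥ 1`.

* `orbit_rectangle_heavy` — for every loopless non-3-colourable `H` on `Fin n` and every cut `B`, an explicit
  cut rectangle over `B` inside NON-3-COL of `orbitMeasure H`-mass `≥ (n - |B|)! / n!`;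
* `foolingMeasure_false_for_orbitMeasures` — **X1 restricted to orbit measures is false**: the statement
  obtained from `FoolingMeasure` by replacing "∃ μ (any probability measure …)" with "∃ H, μ = orbitMeasure H"
  fails.  So every X1 candidate needs internal randomness (`≥ C·n + Ω(n)` bits inside every near-half, and by
  the class-size-profile duties in fact much more — see the line card `Cruxes/FoolingMeasure/Lines/duty.md`).

HONEST FRAMING: a counting observation (placement entropy of half a vertex set is `(n/2)·log₂ n − Θ(n)`, just
below the threshold); FRONTIER material for a rung of Fagin's complement ladder; nothing here bears on P vs NP.
-/

set_option linter.dupNamespace false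
set_option autoImplicit false

namespace Summit.PneNP.PneNP.Theorems.AeaCutRectanglesOrbitMeasures

open Finset
open Summit.PneNP.PneNP.Theorems.AeaCutRectanglesDutyRectangles
open Summit.PneNP.PneNP.Theorems.AeaCutRectanglesDutyTransport
open Summit.PneNP.PneNP.Theorems.AeaCutRectanglesDutySymmetric

variable {n : ℕ}

/-! ### Orbit measures -/

/-- The indicator of a single edge set. -/
noncomputable def pointMass (H : Finset (Sym2 (Fin n))) : Finset (Sym2 (Fin n)) → ℝ :=
  fun G => if G = H then 1 else 0

/-- The ORBIT MEASURE of `H`: a uniformly random relabelling of `H` (`= symmetrise (pointMass H)`). -/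
noncomputable def orbitMeasure (H : Finset (Sym2 (Fin n))) : Finset (Sym2 (Fin n)) → ℝ :=
  symmetrise (pointMass H)

/-- `pointMass` is non-negative. -/
theorem pointMass_nonneg (H S : Finset (Sym2 (Fin n))) : 0 ≤ pointMass H S := by
  unfold pointMass
  split_ifs <;> norm_num

/-- `pointMass` has total mass `1`. -/
theorem pointMass_sum (H : Finset (Sym2 (Fin n))) : ∑ S, pointMass H S = 1 := by
  simp [pointMass, Finset.sum_ite_eq']

/-- `pointMass H` is supported on `{H}`. -/
theorem pointMass_support {H : Finset (Sym2 (Fin n))} (hl : ∀ e ∈ H, ¬ e.IsDiag)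
    (hc : ¬ (SimpleGraph.fromEdgeSet (H : Set (Sym2 (Fin n)))).Colorable 3) (S : Finset (Sym2 (Fin n)))
    (hS : pointMass H S ≠ 0) :
    (∀ e ∈ S, ¬ e.IsDiag) ∧ ¬ (SimpleGraph.fromEdgeSet (S : Set (Sym2 (Fin n)))).Colorable 3 := by
  unfold pointMass at hS
  split_ifs at hS with h
  · subst h
    exact ⟨hl, hc⟩
  · exact (hS rfl).elim

/-- The orbit measure is a probability measure on loopless non-3-colourable edge sets (when `H` is one). -/
theorem orbitMeasure_prob {H : Finset (Sym2 (Fin n))} (hl : ∀ e ∈ H, ¬ e.IsDiag)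
    (hc : ¬ (SimpleGraph.fromEdgeSet (H : Set (Sym2 (Fin n)))).Colorable 3) :
    (∀ S, 0 ≤ orbitMeasure H S) ∧ (∑ S, orbitMeasure H S = 1) ∧
    (∀ S, orbitMeasure H S ≠ 0 → (∀ e ∈ S, ¬ e.IsDiag) ∧
      ¬ (SimpleGraph.fromEdgeSet (S : Set (Sym2 (Fin n)))).Colorable 3) :=
  ⟨symmetrise_nonneg (pointMass_nonneg H), symmetrise_sum (pointMass_sum H),
    symmetrise_support (pointMass_support hl hc)⟩

/-- Unfolding the orbit measure: `orbitMeasure H G = #{σ : relabel σ G = H} / n!`-style sum. -/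
theorem orbitMeasure_apply (H G : Finset (Sym2 (Fin n))) :
    orbitMeasure H G = (∑ σ : Equiv.Perm (Fin n), if relabel σ G = H then (1 : ℝ) else 0) /
      (Fintype.card (Equiv.Perm (Fin n)) : ℝ) := rfl

/-! ### Permutations fixing the cut pointwise do not change Bob's side -/

/-- A permutation fixing `B` pointwise maps non-members of `B` to non-members. -/
theorem not_mem_of_fix {B : Finset (Fin n)} {τ : Equiv.Perm (Fin n)} (hτ : ∀ x ∈ B, τ x = x)
    {x : Fin n} (hx : x ∉ B) : τ x ∉ B := by
  intro h
  have h1 : τ (τ x) = τ x := hτ _ h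
  exact hx (τ.injective h1 ▸ h)

/-- Relabelling by a permutation fixing `B` pointwise does not change the edges inside `B`. -/
theorem bobSide_relabel_of_fix {B : Finset (Fin n)} {τ : Equiv.Perm (Fin n)} (hτ : ∀ x ∈ B, τ x = x)
    (H : Finset (Sym2 (Fin n))) : bobSide B (relabel τ H) = bobSide B H := by
  -- an edge inside `B` is fixed by `Sym2.map τ`, and only edges inside `B` map to edges inside `B`
  have fix_edge : ∀ e : Sym2 (Fin n), (∀ v ∈ e, v ∈ B) → Sym2.map τ e = e := by
    intro e he
    induction e using Sym2.ind with
    | h a b =>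
      rw [Sym2.map_mk, hτ a (he a (Sym2.mem_mk_left a b)), hτ b (he b (Sym2.mem_mk_right a b))]
  have inside_of_map : ∀ e : Sym2 (Fin n), (∀ v ∈ Sym2.map τ e, v ∈ B) → ∀ v ∈ e, v ∈ B := by
    intro e he v hv
    by_contra hvB
    exact not_mem_of_fix hτ hvB (he (τ v) (Sym2.mem_map.2 ⟨v, hv, rfl⟩))
  ext e
  rw [mem_bobSide, mem_bobSide, mem_relabel]
  constructor
  · rintro ⟨⟨e', he', rfl⟩, hin⟩
    have hin' : ∀ v ∈ e', v ∈ B := inside_of_map e' hin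
    rw [fix_edge e' hin']
    exact ⟨he', hin'⟩
  · rintro ⟨he, hin⟩
    exact ⟨⟨e, he, fix_edge e hin⟩, hin⟩

/-- At least `(n - |B|)!` permutations of `Fin n` fix `B` pointwise (those of the complement, extended by the
identity). -/
theorem card_fix_ge (B : Finset (Fin n)) :
    (n - B.card).factorial ≤ (univ.filter fun σ : Equiv.Perm (Fin n) => ∀ x ∈ B, σ x = x).card := by
  classical
  have hsub : (univ : Finset (Equiv.Perm {x // x ∉ B})).image
      (Equiv.Perm.ofSubtype : Equiv.Perm {x // x ∉ B} → Equiv.Perm (Fin n)) ⊆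
      univ.filter fun σ : Equiv.Perm (Fin n) => ∀ x ∈ B, σ x = x := by
    intro σ hσ
    obtain ⟨τ, -, rfl⟩ := mem_image.1 hσ
    refine mem_filter.2 ⟨mem_univ _, fun x hx => ?_⟩
    exact Equiv.Perm.ofSubtype_apply_of_not_mem τ (by simpa using hx)
  calc (n - B.card).factorial = Fintype.card (Equiv.Perm {x // x ∉ B}) := by
        rw [Fintype.card_perm, Fintype.card_subtype_compl, Fintype.card_coe, Fintype.card_fin]
    _ = ((univ : Finset (Equiv.Perm {x // x ∉ B})).image
          (Equiv.Perm.ofSubtype : Equiv.Perm {x // x ∉ B} → Equiv.Perm (Fin n))).card := by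
        rw [card_image_of_injective _ Equiv.Perm.ofSubtype_injective, card_univ]
    _ ≤ _ := card_le_card hsub

/-! ### The heavy rectangle -/

/-- **Every orbit measure has a heavy cut rectangle over every cut.**  For a loopless non-3-colourable `H` and
any cut `B`: the families `𝓐 = {α loopless, edges meeting the outside, α ∪ H[B] non-3-colourable}` and
`𝓑 = {H[B]}` form a cut rectangle over `B` inside NON-3-COL (X1's three hypotheses) of `orbitMeasure H`-mass
at least `(n - |B|)! / n!` (every relabelling of `H` by a permutation fixing `B` pointwise lies in it). -/
theorem orbit_rectangle_heavy (H : Finset (Sym2 (Fin n))) (hl : ∀ e ∈ H, ¬ e.IsDiag)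
    (hc : ¬ (SimpleGraph.fromEdgeSet (H : Set (Sym2 (Fin n)))).Colorable 3) (B : Finset (Fin n)) :
    ∃ 𝓐 𝓑 : Finset (Finset (Sym2 (Fin n))),
      (∀ α ∈ 𝓐, ∀ e ∈ α, ¬ e.IsDiag ∧ ∃ v ∈ e, v ∉ B) ∧
      (∀ β ∈ 𝓑, ∀ e ∈ β, ¬ e.IsDiag ∧ ∀ v ∈ e, v ∈ B) ∧
      (∀ α ∈ 𝓐, ∀ β ∈ 𝓑,
        ¬ (SimpleGraph.fromEdgeSet ((α ∪ β : Finset (Sym2 (Fin n))) : Set (Sym2 (Fin n)))).Colorable 3) ∧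
      ((n - B.card).factorial : ℝ) / (n.factorial : ℝ) ≤ ∑ q ∈ 𝓐 ×ˢ 𝓑, orbitMeasure H (q.1 ∪ q.2) := by
  classical
  set β₀ := bobSide B H with hβ₀
  set 𝓐 : Finset (Finset (Sym2 (Fin n))) := univ.filter fun α =>
      (∀ e ∈ α, ¬ e.IsDiag ∧ ∃ v ∈ e, v ∉ B) ∧
      ¬ (SimpleGraph.fromEdgeSet ((α ∪ β₀ : Finset (Sym2 (Fin n))) : Set (Sym2 (Fin n)))).Colorable 3
    with h𝓐
  refine ⟨𝓐, {β₀}, fun α hα => ((mem_filter.1 hα).2).1, ?_, ?_, ?_⟩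
  · intro β hβ e he
    rw [mem_singleton] at hβ
    subst hβ
    obtain ⟨heH, hin⟩ := mem_bobSide.1 he
    exact ⟨hl e heH, hin⟩
  · intro α hα β hβ
    rw [mem_singleton] at hβ
    subst hβ
    exact ((mem_filter.1 hα).2).2
  · -- the sum over the rectangle is the sum over `α ∈ 𝓐` of `μ (α ∪ β₀)`
    rw [Finset.sum_product, show ∑ α ∈ 𝓐, ∑ β ∈ ({β₀} : Finset _), orbitMeasure H (α ∪ β)
        = ∑ α ∈ 𝓐, orbitMeasure H (α ∪ β₀) from sum_congr rfl fun α _ => sum_singleton _ _]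
    simp only [orbitMeasure_apply]
    rw [← sum_div, Fintype.card_perm, Fintype.card_fin]
    refine div_le_div_of_nonneg_right ?_ (Nat.cast_nonneg _)
    rw [sum_comm]
    -- every permutation fixing `B` pointwise contributes at least `1`
    have key : ∀ σ : Equiv.Perm (Fin n), (∀ x ∈ B, σ x = x) →
        (1 : ℝ) ≤ ∑ α ∈ 𝓐, if relabel σ (α ∪ β₀) = H then (1 : ℝ) else 0 := by
      intro σ hσ
      -- the Alice side of `relabel σ⁻¹ H` is in `𝓐` and relabels back to `H` together with `β₀`
      have hσ' : ∀ x ∈ B, σ.symm x = x := fun x hx => by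
        conv_lhs => rw [← hσ x hx]
        exact σ.symm_apply_apply x
      set G := relabel σ.symm H with hG
      have hGl : ∀ e ∈ G, ¬ e.IsDiag := relabel_loopless hl
      have hGc : ¬ (SimpleGraph.fromEdgeSet (G : Set (Sym2 (Fin n)))).Colorable 3 := by
        rw [hG, colorable_relabel_iff]
        exact hc
      have hGB : bobSide B G = β₀ := by rw [hG, bobSide_relabel_of_fix hσ' H]
      have hsplit : aliceSide B G ∪ β₀ = G := by rw [← hGB, aliceSide_union_bobSide]
      have hmem : aliceSide B G ∈ 𝓐 := by
        refine mem_filter.2 ⟨mem_univ _, fun e he => ?_, ?_⟩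
        · obtain ⟨heG, hout⟩ := mem_aliceSide.1 he
          exact ⟨hGl e heG, hout⟩
        · rw [hsplit]
          exact hGc
      have hback : relabel σ (aliceSide B G ∪ β₀) = H := by rw [hsplit, hG, relabel_relabel_symm]
      calc (1 : ℝ) = if relabel σ (aliceSide B G ∪ β₀) = H then (1 : ℝ) else 0 := by rw [if_pos hback]
        _ ≤ ∑ α ∈ 𝓐, if relabel σ (α ∪ β₀) = H then (1 : ℝ) else 0 :=
            single_le_sum (f := fun α => if relabel σ (α ∪ β₀) = H then (1 : ℝ) else 0)
              (fun α _ => by split_ifs <;> norm_num) hmem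
    calc ((n - B.card).factorial : ℝ)
        ≤ ((univ.filter fun σ : Equiv.Perm (Fin n) => ∀ x ∈ B, σ x = x).card : ℝ) := by
          exact_mod_cast card_fix_ge B
      _ = ∑ σ ∈ univ.filter (fun σ : Equiv.Perm (Fin n) => ∀ x ∈ B, σ x = x), (1 : ℝ) := by simp
      _ ≤ ∑ σ ∈ univ.filter (fun σ : Equiv.Perm (Fin n) => ∀ x ∈ B, σ x = x),
            ∑ α ∈ 𝓐, if relabel σ (α ∪ β₀) = H then (1 : ℝ) else 0 :=
          sum_le_sum fun σ hσ => key σ (mem_filter.1 hσ).2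
      _ ≤ ∑ σ, ∑ α ∈ 𝓐, if relabel σ (α ∪ β₀) = H then (1 : ℝ) else 0 :=
          sum_le_sum_of_subset_of_nonneg (filter_subset _ _)
            (fun σ _ _ => sum_nonneg fun α _ => by split_ifs <;> norm_num)

/-! ### The counting inequality `(n-b)!/n! > 2^{-(n/2)·log₂ n - n}` for `b ≤ n/2` -/

/-- `n! ≤ n^b · (n-b)!` (as naturals), from `n! = (n-b)! · n^{(b)}` and `n^{(b)} ≤ n^b`. -/
theorem factorial_le_pow_mul (b : ℕ) (hb : b ≤ n) : n.factorial ≤ n ^ b * (n - b).factorial := by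
  rw [← Nat.factorial_mul_descFactorial hb, mul_comm]
  exact Nat.mul_le_mul_right _ (Nat.descFactorial_le_pow n b)

/-- The orbit-measure mass beats X1's threshold with `C = 1`: `2^{-(n/2)·log₂ n - n} < (n-b)!/n!` whenever
`2b ≤ n` and `1 ≤ n`. -/
theorem threshold_lt_ratio {b : ℕ} (hb : 2 * b ≤ n) (hn : 1 ≤ n) :
    (2 : ℝ) ^ (-((n : ℝ) / 2 * Real.logb 2 n) - (1 : ℝ) * n) <
      ((n - b).factorial : ℝ) / (n.factorial : ℝ) := by
  have hn0 : (0 : ℝ) < n := by exact_mod_cast hn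
  have hbn : b ≤ n := by omega
  -- (n-b)!/n! ≥ 1/n^b
  have hfac : (0 : ℝ) < (n.factorial : ℝ) := by exact_mod_cast Nat.factorial_pos n
  have h1 : (1 : ℝ) / (n : ℝ) ^ b ≤ ((n - b).factorial : ℝ) / (n.factorial : ℝ) := by
    rw [div_le_div_iff₀ (by positivity) hfac, one_mul]
    have h := factorial_le_pow_mul b hbn
    rw [mul_comm] at h
    exact_mod_cast h
  -- 1/n^b ≥ 2^{-(n/2) log₂ n} = n^{-(n/2)}
  have h2 : (2 : ℝ) ^ (-((n : ℝ) / 2 * Real.logb 2 n)) ≤ (1 : ℝ) / (n : ℝ) ^ b := by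
    have hpow : (2 : ℝ) ^ ((n : ℝ) / 2 * Real.logb 2 n) = (n : ℝ) ^ ((n : ℝ) / 2) := by
      rw [mul_comm, Real.rpow_mul (by norm_num), Real.rpow_logb (by norm_num) (by norm_num) hn0]
    rw [Real.rpow_neg (by norm_num), hpow, one_div]
    apply inv_anti₀ (by positivity)
    calc ((n : ℝ) ^ b) = (n : ℝ) ^ ((b : ℕ) : ℝ) := (Real.rpow_natCast _ _).symm
      _ ≤ (n : ℝ) ^ ((n : ℝ) / 2) := by
          apply Real.rpow_le_rpow_of_exponent_le (by exact_mod_cast hn)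
          have : (2 * b : ℝ) ≤ n := by exact_mod_cast hb
          linarith
  -- strictness from the extra factor 2^{-n}
  have h3 : (2 : ℝ) ^ (-((n : ℝ) / 2 * Real.logb 2 n) - (1 : ℝ) * n) <
      (2 : ℝ) ^ (-((n : ℝ) / 2 * Real.logb 2 n)) :=
    Real.rpow_lt_rpow_of_exponent_lt (by norm_num) (by linarith)
  exact h3.trans_le (h2.trans h1)

/-! ### X1 restricted to orbit measures is false -/

/-- **Orbit measures cannot witness X1.**  The weakening of the construction space of
`Summit.PneNP.PneNP.Theses.AeaCutRectangles.FoolingMeasure` to ORBIT MEASURES (uniform relabellings of one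
loopless non-3-colourable graph per `n`) makes the statement FALSE: at `C = 1`, for every large `n` and every
`H`, the cut of size `⌊n/2⌋` carries the heavy rectangle of `orbit_rectangle_heavy`.  (AEA.md Prop 6.4(f);
WITNESS-g1 §5.)  Any X1 measure therefore needs internal randomness beyond placement. -/
theorem foolingMeasure_false_for_orbitMeasures :
    ¬ ∃ ε : ℝ, 0 < ε ∧ ε ≤ 1 / 4 ∧ ∀ C : ℕ, ∃ᶠ n in Filter.atTop, ∃ H : Finset (Sym2 (Fin n)),
      (∀ e ∈ H, ¬ e.IsDiag) ∧ ¬ (SimpleGraph.fromEdgeSet (H : Set (Sym2 (Fin n)))).Colorable 3 ∧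
      ∀ B : Finset (Fin n), (1 / 2 - ε) * (n : ℝ) ≤ B.card → (B.card : ℝ) ≤ (1 / 2 + ε) * n →
        ∀ 𝓐 𝓑 : Finset (Finset (Sym2 (Fin n))),
          (∀ α ∈ 𝓐, ∀ e ∈ α, ¬ e.IsDiag ∧ ∃ v ∈ e, v ∉ B) →
          (∀ β ∈ 𝓑, ∀ e ∈ β, ¬ e.IsDiag ∧ ∀ v ∈ e, v ∈ B) →
          (∀ α ∈ 𝓐, ∀ β ∈ 𝓑,
            ¬ (SimpleGraph.fromEdgeSet ((α ∪ β : Finset (Sym2 (Fin n))) : Set (Sym2 (Fin n)))).Colorable 3) →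
          ∑ q ∈ 𝓐 ×ˢ 𝓑, orbitMeasure H (q.1 ∪ q.2) ≤
            (2 : ℝ) ^ (-((n : ℝ) / 2 * Real.logb 2 n) - (C : ℝ) * n) := by
  rintro ⟨ε, hε0, -, hC⟩
  -- work at C = 1 and some n ≥ ⌈1/ε⌉ + 1 from the frequently-set
  obtain ⟨N, hN⟩ := exists_nat_gt (1 / ε)
  obtain ⟨n, hnN, H, hl, hc, hX⟩ := Filter.frequently_atTop.1 (hC 1) (N + 1)
  have hn1 : 1 ≤ n := by omega
  have hnε : (1 : ℝ) ≤ ε * n := by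
    have hNn : (N : ℝ) ≤ n := by exact_mod_cast (show N ≤ n by omega)
    have h := mul_le_mul_of_nonneg_left hNn hε0.le
    have h' : 1 < ε * N := by
      rw [div_lt_iff₀ hε0] at hN
      linarith
    linarith
  -- the cut: the first ⌊n/2⌋ vertices
  set b : ℕ := n / 2 with hb
  have hblt : b < n := by omega
  set B : Finset (Fin n) := Finset.Iio (⟨b, hblt⟩ : Fin n) with hB
  have hBcard : B.card = b := by
    rw [hB, Fin.card_Iio]
  have h2b : 2 * b ≤ n := by omega
  -- the window
  have hwin1 : (1 / 2 - ε) * (n : ℝ) ≤ B.card := by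
    rw [hBcard]
    have : (n : ℝ) ≤ 2 * (b : ℝ) + 1 := by exact_mod_cast (show n ≤ 2 * b + 1 by omega)
    nlinarith
  have hwin2 : (B.card : ℝ) ≤ (1 / 2 + ε) * n := by
    rw [hBcard]
    have : 2 * (b : ℝ) ≤ n := by exact_mod_cast h2b
    nlinarith
  obtain ⟨𝓐, 𝓑, h𝓐, h𝓑, hN', hmass⟩ := orbit_rectangle_heavy H hl hc B
  have hle := hX B hwin1 hwin2 𝓐 𝓑 h𝓐 h𝓑 hN'
  have hlt := threshold_lt_ratio (n := n) h2b hn1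
  rw [hBcard] at hmass
  push_cast at hle
  linarith

end Summit.PneNP.PneNP.Theorems.AeaCutRectanglesOrbitMeasures
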